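import Summits.AtomisticToContinuum.Crystallization.Theses.GappedShellCensus
import Summits.AtomisticToContinuum.Crystallization.Theorems.FiveFoldRationingR.Negative.Hypotheses
import Summits.AtomisticToContinuum.Crystallization.Theorems.FiveFoldRationingR.Negative.OneShell
import Summits.AtomisticToContinuum.Crystallization.Theorems.FiveFoldRationingR.Negative.OpenStar
import Summits.AtomisticToContinuum.Crystallization.Theorems.FiveFoldRationingR.Negative.ToleranceOnset

/-!
# Disproof of `FiveFoldRationingR` — findings (cdisprove seat, cycle 1 + resume, 2026-08-17)

Crux (stmt-AtomisticToContinuum-18071, route GappedShellCensus, rank 6):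
`∀ Y a, 0 < a → Y.Nonempty → Gapped(a,1/50,63/50) everywhere → TornFree (every bond ≥ 4 common) →
 ∀ R, ∃ c ∈ Y, every bond (y,v) with dist y c ≤ R has ≤ 4 common neighbours` (five-ring-free balls of
every radius).  VERDICT SO FAR: NO KILL.  Index of what is certified (LANDED under
`Theorems/FiveFoldRationingR/Negative/` and IMPORTED here — §§ (a), (c), (c′)) / recorded here:

(a) LOAD-BEARING ANALYSIS (theorems, sorry-free, `decide` + `norm_intVec` transfer):
  * `fiveFoldRationingR_false_without_nonempty` — `Y.Nonempty` is load-bearing (`Y = ∅`).  [p138319, Hypotheses.lean]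
  * `scale_pos_of_gappedTwelve` — `0 < a` is DECORATION (implied by Nonempty + twelve-within-`1.02a`).  [p138319]
  * `fiveFoldRationingR_false_without_allSites` — the ONE-SHELL-DEEP local form (hypotheses only at `y`
    and its twelve neighbours, conclusion "no capped bond at `y`" = the crux at `R = 0` with the centre
    prescribed) is FALSE: honest 55-point fragment of the all-gapped DECAHEDRAL ROD.  [p138148, OneShell.lean]
    ⇒ any proof must RATION (use the hypotheses unboundedly far away / the free centre `c`); no local
    exclusion of five-rings at any finite depth (rod numerics in (b)).
(b) TIGHTNESS / NATURAL STRENGTHENINGS: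
  * `not_fiveFoldExclusion` (near-miss, `sorry` = infinite witness, § (b) below): the conclusion cannot be
    upgraded to "no capped bond anywhere" — the infinite squeezed decahedral rod (`rod/decrod.py` in the
    seat folder: five fcc wedges of dihedral `arccos(1/3)` about a `[110]` axis, azimuthal squeeze
    `×1.02085`, fcc bond `0.98986a`) is all-gapped-twelve AND torn-free, bond lengths in
    `[0.98986a, 1.01014a]`, non-bonded pairs `≥ 1.3998a`, exactly the axis bonds capped (checked on `235`
    inner sites of a `1524`-site chunk; the squeeze is uniform in `r`, so every depth is alike — the
    barrier `DecahedralSoftShell`'s evasion (iii) "strain growing with the distance from the axis" does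
    not happen for this map).
  * ROD-CLASS RIGIDITY (paper, this seat): configurations invariant under the axial translation by `a`
    with all sites on full `[110]` columns (every Barlow stacking seen along an in-plane row, the rod, any
    forest of PARALLEL five-fold axes): gapped-twelve + torn-free force the cross-section to be a
    2-coloured triangulation by ONE isosceles tile (base = same-colour bond `≈ a`, legs = opposite-colour
    bonds of planar length `≈ (√3/2)a`) with two vertex types only, `(s,d) = (2,4)` (flat:
    `4·54.74° + 2·70.53° = 360°`) and `(0,5)` (five-fold, deficit `ω₅ = 7.36°`); same-colour equilateral
    tiles are TORN (≤ 3 common neighbours across the base), squashed cells cannot occur.  Cohn-Vossen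
    then caps the number of five-fold columns at `⌊2π/ω₅⌋ = 48` in the WHOLE configuration; rattack F5
    (`≤ 1` by hoop strain) and the ideal chamber count (grain polygons would need corners in
    `{70.5°, 109.5°}` summing to `(n−2)·180°` — impossible — so the twin-trace graph has no bounded face
    and two axes can share no sheet) both give `≤ 1`.  ⇒ no counterexample is rod-like / parallel-axis; a
    kill needs genuinely NON-T/O cells.
(c) SMALL-MODEL REFUTATION OF A STRENGTHENED PROOF STEP (theorem, sorry-free):
  * `cappedRingClosed_false` — "capped ⇒ closed five-ring" is FALSE at the level of the bond's own
    7-point star under pairwise band/gap constraints: the OPEN FIVE-STAR (`4T+Q`: bond `0.9825`, spokes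
    `1.0175`, four ring bonds `0.9825`, open pair `1.2856`) is pairwise legal (crude axial budget
    `4·66.4° + 89.5° = 355° < 360°`); it survives `0.45 %` uniform slack and dies at `0.5 %`.  So the SIGN
    of curvature at a capped bond ((5,0) against the negative, (4,1)-like open star) must come from the
    TWELVE-NESS of the two shells.  [p138905, OpenStar.lean]
    Hand analysis of the full shell about an open star (why the scans find none): with `v` north and
    `w₁…w₅` at polar `≈ 61.3°` (azimuth gaps `66.4°×4, 94.4°`), the six remaining points lie at polar
    `≥ 78.1°`; `w₁, w₅` need two more bonds each, `w₂…w₄` one.  A point bonded to two consecutive `w`'s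
    sits at polar `≈ 112°` (at `110°` it is `58.3°` from them — too close; at `118.7°` it is `65.6°` — in
    the forbidden angular band `(61.3°, 78.1°)`), a point bonded across the open gap at polar `≈ 100°`;
    that lower ring has a chord `u₄₅–u₅₁ = 1.2505` in the forbidden band (margin `−0.01`) and leaves the
    TWELFTH point no legal place (the south cap is `≤ 68°` from the ring: neither bonded nor far).
    Exactly-twelve is what kills it, as in the `13`-sphere problem.
  * (c′) TOLERANCE ONSET of the one-shell local alphabet [p141208 ACCEPTED, `Negative/ToleranceOnset.lean`;
    § (c′) below]: `noBranchingOneShellAt_false` — "≤ 2 capped bonds at a gapped-twelve torn-free site"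
    (NB) is FALSE at `13/500` (regular icosahedral 13-cluster, `n₅ = 12`; exact onset `(1+τ)/(1−τ) =
    1/sin 72°`, `τ* = 2.5086 %`); `closedStarOneShellAt_false` — "capped ⇒ closed five-ring" with the full
    twelve-shell and torn-freeness (CS) is FALSE at `3/100` (the open-pair `4T+Q` shell: two ADJACENT capped
    poles `64°` apart, both stars open; commonest class of the `3 %` census, 185/424; by continuation it
    lives down to `τ ≈ 2.75 %`).  With (d): the crux's `1/50` is protected by `≈ 0.5 %` of tolerance only.
    PENTAGON FACE, same style (why `SectorClosure` resists at `1/50`): an empty pentagon `p₁…p₅` of side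
    `60°` has circumradius `58.3°` (diagonals `108°`, fine).  Each `p_k` needs two more bonds from the seven
    outer points, each of which is bonded (`[58.7°, 61.3°]`) or far (`≥ 78.1°`) from EVERY `p_k`.  A point
    bonded to two consecutive `p`'s sits at polar `107.3°`; five such points are pairwise `68.3°` apart —
    forbidden — and making them bonded (`polar 119.9°`, then `70.4°` from the `p`'s) or far (impossible,
    `sin²θ ≥ 1.15`) fails.  A point bonded to ONE `p_k` and far from its neighbours sits radially below it
    at polar `≈ 118–120°`; five of them are `62.3°` apart at `118.3°` (forbidden by `1°`) and bonded only
    from polar `119.9°`, where they are `61.6°` from their `p` (forbidden by `0.3°`); even granting both,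
    the `p`'s have degree `3` (TORN) and the shell closes with a capped south pole at ELEVEN points, the
    twelfth having no legal place.  This is exactly the boundary zoo the censuses see (pentagons come with
    degree-3 vertices); torn-free + pentagon misses by `≈ 1°–3°` of arc, i.e. it would need tolerance
    `≈ 4–5 %`, not `2 %`.  (Margins this thin are why the certificate must be interval arithmetic, and why
    the scans' failure is informative but not a proof.)
(d) SEARCHES (kit, this seat; `-- Targets`: payload.stuck_stubs = [] this cycle):
  * kit j022055 (this seat, 25 min × 4 cores, 19 286 restarts, script `job1/main.py`, stdout attached as
    evidence `j022055_stdout.log`): SEEDED + FORCED single-shell census at (1/50, 63/50) — L-BFGS-B penalty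
    descent with analytic gradients, a `degree ≥ 4` term (torn-free bias), basin hopping near the
    feasibility boundary of each forced motif, classification of every feasible shell by (E, degrees, face
    vector, cyclic corner words).  Modes: `free` (control), `pentseed`/`pent` (empty pentagon cap, forced
    emptiness margins 0.02/0.08), `hexseed`/`hex`, `five2`/`five2psiψ` (two 5-valent poles at forced angle
    ψ = 60°, 90°, 120°, 150°), `five4`, `five6`, `star<patt>` (a shell vertex with a forced star: `BBBBB` =
    closed five-ring (control), `BBBBO` = open 4T+Q star, `BBBO` = 3T+Q, `BOOO` = T+3Q, `OOOO` = 4Q squashed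
    octahedron, `BBBOO`, `BBOBO`, `BBOO`/`BOBO` = TTOO/TOTO controls).
    RESULT: 883 feasible shells, ALL torn-free, in exactly THREE classes — (8,6) `QQTT`+`QTQT`
    (anticuboctahedral family, 308), the bicapped pentagonal prism (10,5) with poles `TTTTT` at
    `177.9°–178°` (132), the cuboctahedron `QTQT` (53).  FLAGS: torn-free with a ≥5-face 0; with E ≥ 26
    (n₅ ≥ 4) 0; with non-antipodal poles (< 150°) 0; with a corner word outside {TOTO, TTOO, T⁵} 0.  Every
    control mode found its target (free 370, five2 73, starBBBBB 13, starBBOO 17, starBOBO 20); NO exotic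
    forced mode reached feasibility.  Best residuals (Σ violation², lengths in units of a) and what the
    optimum "wants": `starBBBBO` 9.3e-4 (cores 0.975–0.978, gaps 1.022–1.027: needs τ ≈ 2.5–2.7 %),
    `starBBBO` 9.0e-4 (same pattern), `five4` 9.5e-4 (ALL radii 0.972, 18 pairs at 1.0219: the n₅ = 4
    shell is a uniformly shrunk near-icosahedral object needing τ ≈ 2.8 %), `five6` 9.6e-4 (idem),
    `pentseed` 7.7e-4, `hexseed` 7.8e-4, `five2psi60` 2.1e-3, `five2psi120` 3.7e-3, `pent` (forced empty)
    4.6e-3, `starBOOO` 3.4e-3, `starBBOBO` 1.0e-2, `hex` 1.6e-2, `five2psi90` 2.4e-2, `five2psi150`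
    3.4e-2, `starBBBOO` 3.7e-2, `starOOOO` 5.3e-2.  READING: at τ = 1/50 the exotic torn-free motifs miss
    by 0.5–0.8 % of tolerance, uniformly spread over many constraints (no single bottleneck); the onset of
    the non-T/O zoo is bracketed next.  The crux's 1/50 sits just under that onset, like its other
    band-edge numbers (single-rod hoop strain 2.04 %, open-star slack 0.45 %).
  * BRACKETS kit j022307 (τ = 3 %, 10 260 restarts) / j022308 (τ = 2.5 %, 7 867 restarts), same script:
    at 2.5 % NOTHING new — 3 torn-free classes ((8,6) ×2, prism with poles `176.6°`), 0 torn, flags all 0,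
    forced exotic modes infeasible (best: `five4`/`five6` 2.7e-7 = the uniformly shrunk icosahedron at radius
    `0.9749 < 0.975`, i.e. `0.01 %` short — exact onset `2.5086 %`; `starBBBBO` 3.5e-5; `five2psi60`
    4.6e-4; `pent` 1.65e-3).  At 3 % the zoo is OPEN: 10 torn-free classes incl. E = 26/27/30 (`n₅ = 4, 6,
    12`), pole pairs at `60°–64°` and `109°–118°`, corner word `QTTTT` (open `4T+Q` star) in the COMMONEST
    class (185/424: E = 25 with two adjacent open-star poles), 59 feasible `starBBBBO`, 45 `starBBBO`; but
    empty ≥5-faces are STILL infeasible at 3 % (`pent` 1.86e-4, `hex` 4.7e-3; torn-free with a ≥5-face: 0) —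
    SectorClosure has more room than NoBranching / ClosedStar.  ⇒ onset of (NB)/(CS) failure ∈ (2.5 %, 2.75 %].
  * kit j022179 (job2, `job2/main.py`, 25 min × 4 cores, 1 017 restarts): PERIODIC all-gapped-twelve
    cells with a FORCED capped bond (n = 7…20 sites/cell, free triclinic cell, exactly-twelve via
    12th-nearest `≤ 1.02` / 13th `≥ 1.26`, random + perturbed fcc/hcp supercell starts, basin hopping;
    control `free`).  RESULT: control found 50 feasible cells (n = 8: 18, 12: 16, 16: 16), EVERY bond
    exactly 4-common (Barlow cells, as rattack's j021140 part B: 681/2400); forced-capped 0 feasible of 798,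
    best residual 5.4e-2 (a five-ring does not fit a Barlow cell at 2 %: violations ≈ 0.2a); random-start
    cells glassy (≥ 0.14).  No periodic candidate, no torn bond either (nothing for TornFree).
  * kit j022652 / j022653 (`job3/main.py` = job2 over settings, 25 min × 4 cores each; slow at large n:
    451 / 670 restarts): forced-capped periodic cells (n = 7…26) at τ = 3, 4, 5 % WITH the gap — tightness of
    the constant: mixed-sign (5,0)+(4,1) periodic structures are conceivable once the open star exists;
    pentagonal-bipyramid and icosahedral-13-cluster starts — and at τ = 2, 3 % with the GAP DROPPED (13th
    neighbour only `≥ 1+τ+0.005`: is `63/50` load-bearing for periodic cells?).  RESULT: 0 feasible of 361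
    (gap, τ ≤ 5 %; best residuals 3.3e-2 – 4.3e-2, always the lattice-start cells n = 8, 12, 16) and 0 of
    523 (no gap, τ ≤ 3 %; best 2.4e-2 – 3.8e-2); controls: 21 + 20 feasible cells, every bond exactly
    4-common (Barlow).  READING (weak, small cells / small sample): no periodic all-twelve cell with a
    five-ring up to 26 sites even at 5 % or without the gap; a mixed-sign periodic T/O structure, if it
    exists at 3–5 %, needs a DESIGNED large cell (decagonal-approximant-like), not random restarts — open.
(e) WHY IT RESISTS (for the provers): inside the T/O class the crux is over-determined — (2,2)/(5,0) are
    the only ring words of genuine band T/O cells, the ideal complex is a flat cone-manifold with cone angle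
    `2π − ω₅` exactly on the five-bonds (CBB(0)), the lune argument gives `n₅(y) ∈ {0,2}` with antipodal
    poles, sheets are planes, and the chamber bookkeeping leaves AT MOST ONE five-fold axis in the whole
    configuration; periodic counterexamples are impossible there (compact CBB(0) torus ⇒ flat).  Every kill
    therefore needs a NON-T/O cell in an all-gapped torn-free configuration, i.e. a torn-free shell with an
    empty ≥5-face or an exotic corner word (4T+Q, 3T+Q, T+3Q, 4Q, …).  (c) shows the ring alone does not
    forbid 4T+Q; the scans (j019259, j020609, j021140 ≈ 30 k restarts, and this seat's seeded / forced
    ones in (d)) realise none at the shell level.  The load-bearing open lemma is single-shell and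
    TWELVE-driven: `SectorClosure` + "every 5-valent vertex of a torn-free gapped shell is `T⁵`" (card
    single-shell-octet-lock) — certify those two (interval branch-and-bound over the `≤ 20` combinatorial
    stars / face types) and the crux follows by known comparison geometry.

Every `def … : Prop` in the imported Negative files is a hypothesis-analysis predicate of THIS crux.
-/

noncomputable section

namespace Summit.AtomisticToContinuum.Crystallization.Cruxes.FiveFoldRationingR.Disproof

open Literature.Geometry.DiscreteGeometry
open Summit.AtomisticToContinuum.Crystallization.Theses.GappedShellCensus
open Summit.AtomisticToContinuum.Crystallization.Theorems.FiveFoldRationingR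

/-! ## (a) Load-bearing analysis — LANDED as `Theorems/FiveFoldRationingR/Negative/Hypotheses.lean` (p138319) and `…/Negative/OneShell.lean` (p138148); imported above, indexed here -/

/-- `Y.Nonempty` is load-bearing: with `Y = ∅` the crux's body is false. -/
example : ¬ Negative.FiveFoldRationingRWithoutNonempty :=
  Negative.fiveFoldRationingR_false_without_nonempty

/-- `0 < a` is decoration: implied by `Y.Nonempty` and gapped-twelve. -/
example {Y : Set (EuclideanSpace ℝ (Fin 3))} {a : ℝ} (hY : Y.Nonempty)
    (hG : ∀ y ∈ Y, ({w ∈ Y | w ≠ y ∧ dist y w ≤ a * (1 + 1 / 50)}.ncard = 12 ∧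
      ∀ w ∈ Y, w ≠ y → a * (1 - 1 / 50) ≤ dist y w ∧
        (dist y w ≤ a * (1 + 1 / 50) ∨ a * (63 / 50) ≤ dist y w))) :
    0 < a :=
  Negative.scale_pos_of_gappedTwelve hY hG

/-- "All sites" is load-bearing: the one-shell-deep local form (hypotheses at `y` and its twelve
neighbours, conclusion "no capped bond at `y`") is FALSE — 55-point fragment of the all-gapped decahedral
rod (`Negative.DecRodOneShell`, `decide`). -/
example : ¬ Negative.FiveFoldRationingRWithoutAllSites :=
  Negative.fiveFoldRationingR_false_without_allSites


/-! ## (b) Tightness: the conclusion cannot be upgraded from "clean balls somewhere" to "no five-ring" -/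

/-- `FiveFoldRationingR` with its conclusion STRENGTHENED from "for every `R` some `R`-ball about a site
is five-ring-free" to "no bond of `Y` is capped at all" (five-ring EXCLUSION instead of rationing);
hypotheses verbatim. -/
def FiveFoldExclusion : Prop :=
  ∀ (Y : Set (EuclideanSpace ℝ (Fin 3))) (a : ℝ), 0 < a → Y.Nonempty →
    (∀ y ∈ Y, ({w ∈ Y | w ≠ y ∧ dist y w ≤ a * (1 + 1 / 50)}.ncard = 12 ∧
      ∀ w ∈ Y, w ≠ y → a * (1 - 1 / 50) ≤ dist y w ∧
        (dist y w ≤ a * (1 + 1 / 50) ∨ a * (63 / 50) ≤ dist y w))) →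
    (∀ y ∈ Y, ∀ v ∈ Y, v ≠ y → dist y v ≤ a * (1 + 1 / 50) →
      4 ≤ {w ∈ Y | w ≠ y ∧ w ≠ v ∧ dist y w ≤ a * (1 + 1 / 50) ∧ dist v w ≤ a * (1 + 1 / 50)}.ncard) →
    ∀ y ∈ Y, ∀ v ∈ Y, v ≠ y → dist y v ≤ a * (1 + 1 / 50) →
      {w ∈ Y | w ≠ y ∧ w ≠ v ∧ dist y w ≤ a * (1 + 1 / 50) ∧ dist v w ≤ a * (1 + 1 / 50)}.ncard ≤ 4

/-- NEAR-MISS (true, not formalised): **five-ring exclusion is false** — the infinite, uniformly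
squeezed decahedral rod is all-gapped-twelve and torn-free with every axis bond capped (construction and
numerics: `rod/decrod.py`, module docstring (b); the rattack seat's `DecahedralRodNote` reports the same
object at max strain `0.669 %` under a better strain split).  Obstruction to a Lean proof: the witness is
necessarily INFINITE (no finite set is all-twelve: an extreme point would need twelve neighbours in a
closed half-space, one-sided kissing number `9`), with infinitely many orbits, so the `decide` pattern of
(a) does not apply; a proof would need the fcc lattice `D₃` as a `Set`, the wedge decomposition and a
symbolic treatment of `cos 72°` — days, for a fact nobody disputes.  Its finite shadows at every depth
ARE decidable; depth 1 is `fiveFoldRationingR_false_without_allSites`. -/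
theorem not_fiveFoldExclusion : ¬ FiveFoldExclusion := by
  sorry

/-! ## (c) The ring alone does not close a capped bond — LANDED as `…/Negative/OpenStar.lean` (p138905); imported above -/

/-- Pairwise band/gap constraints do not force the common-neighbour ring of a capped bond to be closed:
the open five-star `Negative.OpenFiveStar` (`4T+Q`) at tolerance `1/50`. -/
example : ¬ Negative.CappedRingClosed :=
  Negative.cappedRingClosed_false

/-! ## (c′) Tolerance onset of the one-shell local alphabet — LANDED as `…/Negative/ToleranceOnset.lean` (p141208, commit c516ba6d06db); imported above

(NB) "at most two capped bonds at a gapped-twelve torn-free site" is FALSE at `13/500` (regular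
icosahedral 13-cluster `Negative.IcoThirteen`; exact onset `(1+τ)/(1−τ) = 1/sin 72°`, `τ* = 2.5086 %`);
(CS) "the ring of a capped bond is closed" (twelve-shell version of (c)) is FALSE at `3/100` (open-pair
`4T+Q` shell `Negative.OpenPairShell` of kit j022307, polished + integerised; survives by continuation down
to `τ ≈ 2.75 %`, absent at `2.5 %` (j022308) and at `1/50` (j022055)).  Margin of the crux's constant:
`≈ 0.5 %` of tolerance. -/

example : ¬ Negative.NoBranchingOneShellAt (13 / 500) :=
  Negative.noBranchingOneShellAt_false

example : ¬ Negative.ClosedStarOneShellAt (3 / 100) :=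
  Negative.closedStarOneShellAt_false


/-! ## (d) Targets / Line `Sketch` (payload.line; `stuck_stubs = []` this cycle)

The lead's skeleton `Cruxes/FiveFoldRationingR/Lines/Sketch.lean` has SIX of seven stubs landed
(p138850 Lens, p138989 Circle, p138519 CommonLeFive = F1, p138760 NoFreeSurface, p138480 RelDense(3a),
p138682 Counting) and the bridge `stub_ffrBridge : census → FiveFoldRationingR` (p139807): JOINT
SUFFICIENCY is kernel-checked, nothing is smuggled — the crux is reduced BY NAME to the one open stub
`stub_ffrCensus` (per-configuration linear census of five-sites: `∃ C, ∀ p r, a ≤ r →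
ncard(five-sites ∩ B(p,r)) ≤ C·r/a`).  Attack record on that stub:
* it is STRICTLY STRONGER than the crux (uniform linear sparsity about every centre versus one clean ball
  per radius) but it has exactly the crux's door: a counterexample is again an infinite all-gapped-twelve
  torn-free `Y`, now with five-site count superlinear in `r` along some sequence of balls; inside the T/O
  alphabet this is impossible for the same reason as the crux (CBB(0) ideal complex: singular length in
  `B_r` is `O(r)` with a constant depending only on `ω₅`; unbranched straight axes), and outside it needs
  the non-T/O shell that the censuses do not find at `1/50`;
* its extra hypotheses F1 and RelDense(3a) are theorems (landed stubs), so dropping them changes nothing;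
  `∃ C` AFTER `∀ Y` makes every configuration with finitely many axes trivially fine; `Set.ncard` has no
  junk here (hard core ⇒ bounded sets are finite);
* no `stub_ffrCensus_false` is claimed.  VERDICT: the stub stands or falls with the crux's own local
  alphabet; the disprover has no separate lever on it.

ADVICE distilled from the failed attacks (for the lead / re-lining):
1. The local alphabet at `1/50` — (SC) faces of the link are triangles / gap-diagonal quads, (NB)
   `n₅(y) ∈ {0,2}` antipodal, (CS) capped ⇒ closed `T⁵` star — is TRUE numerically with a margin of only
   `≈ 0.5 %` of tolerance ((c′): icosahedral onset `2.5086 %` exact, open star `≈ 2.7 %`, non-antipodal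
   pole pairs `≈ 2.6 %`, `n₅ = 4, 6` shells `≈ 2.8 %`; empty pentagon / hexagon faces still infeasible at
   `3 %`, residuals `1.9e-4` / `4.7e-3`).  So the certificate must be METRIC (interval branch-and-bound on
   the `≤ 20` combinatorial types), and it is cheap: every threshold is a 12-point problem.  (NB) at
   `n₅ ∈ {10, 12}` even has a one-line proof: twenty spherical triangles of side `≤ 2 arcsin(0.5204) =
   62.71°` have area `≤ 20 · 0.6114 sr < 4π`.
2. Do the GLOBAL step in the IDEAL polyhedral metric (unit regular cells glued by the certified
   combinatorics), never in real coordinates: real twin sheets of an infinite grain may rotate by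
   `O(τ log r)` over distance `r` at bounded strain (the map `x ↦ R(ε log |x|) x` has strain `O(ε)`), so
   "sheets are planes" is false in `ℝ³` at large scales but exact in the ideal metric, where axes are
   complete straight singular geodesics (ideal (10,5) poles are exactly antipodal), sheets are totally
   geodesic, periodic ⇒ flat (splitting), an isolated five-ring LOOP is impossible (trivial holonomy at
   infinity ⇒ Euclidean volume growth ⇒ flat by Bishop–Gromov rigidity), and Petrunin / 2-D
   Cohn-Vossen give the linear census.  An even cheaper global engine may exist: with the alphabet
   {cubocta, anticubocta, (10,5)-prism} the TTOO-edges form flat sheets ending only on axes, five per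
   axis at ideal dihedral `arccos(1/3)`; no bounded grain polygon has all corners `70.53°`
   (`n · 70.53° ≠ (n−2) · 180°`), and two axes force two of their half-sheets to cross — an incidence
   argument for "at most ONE axis", which implies the crux outright.  Far-field hoop strain (`k` parallel
   axes need `(1−τ)/(1+τ) ≤ 1 − k ω₅/2π`, i.e. `τ ≥ 2.09 %` for `k = 2`) is suggestive but NOT a proof
   (edge-path detour factors of the T/O graph swamp the `0.17 %` margin).
3. What is left for a kill, and was searched: a non-T/O torn-free gapped shell at `1/50` (none: j019259,
   j020609, j021140, j022041, j022055, j022308 — ≈ 60 k restarts incl. seeded/forced modes), or a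
   periodic all-gapped-twelve cell with a capped bond at `1/50` (none: j021140 part B 681 Barlow cells,
   j022179 0/798 forced).  Also none (kit j022652 / j022653, header (d)): periodic forced-capped cells up to 26
   sites at `τ = 3, 4, 5 %` (0/361) and with the GAP HYPOTHESIS DROPPED at `τ = 2, 3 %` (0/523) — so far
   the constant shows no periodic failure up to `5 %` in small cells and the gap `63/50` has not been SEEN
   to be load-bearing; both remain open for designed large cells (next cycle, if granted: build a
   decagonal-approximant-like mixed-sign (5,0)+(4,1) cell at `3–4 %` by hand and relax it).
-/

end Summit.AtomisticToContinuum.Crystallization.Cruxes.FiveFoldRationingR.Disproof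

end
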